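import Literature.AlgebraicGeometry.HodgeTheory.WeilClasses
import Literature.AlgebraicGeometry.HodgeTheory.HodgeConjecture
import Literature.AlgebraicGeometry.HodgeTheory.HodgeModelExistence
import Literature.AlgebraicGeometry.HodgeTheory.HodgeConjectureQbarVoisinProofs
import Literature.AlgebraicGeometry.HodgeTheory.PulledBackAlgebraicClasses
import Literature.AlgebraicGeometry.Motives.AbelianVarietyProjectiveChart

/-!
# Crux `HodgeAbelianVarieties` (stmt-HodgeConjecture-1333), line `subtorus-gallery-bloch-seeds` — stub `stub_andreCM` (`CMWeil[] → HCCM[]`): the honest reduction and the junk audit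

The registered stub `stub_andreCM : CMWeil[] → HCCM[]` of the skeleton
`Cruxes/HodgeAbelianVarieties/Lines/subtorus-gallery-bloch-seeds.lean` is, in print, André's
reduction (Y. André, *Une remarque à propos des cycles de Hodge de type CM*, Progr. Math. 102
(1992) 1–7 = Markman, arXiv:2509.23403, Thm. 1.4, READ: "Let `A` be a complex abelian variety of
CM-type. There exist abelian varieties `Aᵢ` of split Weil type and homomorphisms `fᵢ : A → Aᵢ`, such
that every Hodge class `t` on `A` can be written as a sum `t = Σ fᵢ^*(tᵢ)` with `tᵢ` a Weil class on
`Aᵢ`"; Deligne–Milne, LNM 900, endnote 18), followed by "pull-backs of algebraic classes are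
algebraic" (Voisin II Prop. 9.21 (i) / Fulton Cor. 19.2 (b)) and the existence of Hodge models of
abelian varieties (GAGA + de Rham + Hodge decomposition).

VERDICT (this seat): the stub is TRUE in print and correctly typed, but NOT provable on the tree's
carriers today. André's theorem needs, on `complexBetti`/`pullbackEigenclasses`/`algebraicClasses`:
the uniformisation `A(ℂ) ≅ ℂᵍ/Λ` with `H•(A(ℂ); ℚ) = ⋀• H¹` as a ring (the tree has the cohomology
ring of the abstract torus `(ℝ/ℤ)ⁿ` only, `TorusRationalClasses`; the homeomorphism
`ComplexPoints A.X ≃ₜ (Fin (2 * A.dim) → AddCircle 1)` is an explicit HYPOTHESIS in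
`Motives/JacobianDimensionProofs`), additivity `(f + g)^* = f^* + g^*` on `H¹` for homomorphisms, the
Mumford–Tate torus of a CM abelian variety and its character calculus on `H^{2p}` (the tree's
`mumfordTateGroup` lives on abstract `HodgeStructure V n`, not on `complexBetti A.X`), and above all
the CONSTRUCTION of André's split-Weil-type CM abelian varieties `B_J` (the `A_Φ = ℂᵍ/Φ(𝔞)` / Serre
tensor construction) as bundled `AbelianVariety ℂ` — algebraisation of polarised complex tori — none
of which exists in `Literature`. What this file PROVES instead (sorry-free, axioms
`propext`/`Classical.choice`/`Quot.sound`):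

* `hccm_of_cmWeil_of_andre_of_homPullback` — **the honest reduction**: `CMWeil[]` ∧ `AndreSplitWeil[]`
  ∧ `HomPullback[]` ⟹ `HCCM[]` (given the Hodge-model fact `hM`, below), where `AndreSplitWeil[]` is
  André's decomposition typed VERBATIM in the antecedent shape of `CMWeil[]` (for a CM `A` and a
  rational `(p,p)`-class `c`, `0 < p`: finitely many `(Bᵢ, fᵢ : A ⟶ Bᵢ, ψᵢ ∈ End Bᵢ, Sᵢ ⊂ ℂ ∖ ℝ, tᵢ)`
  with the eigenspaces of `ψᵢ^*` on `H¹(Bᵢ)` for `μ ∈ Sᵢ` exhausting and each of dimension `2p`, `tᵢ`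
  rational of type `(p,p)` in the eigen-span `⨆_{μ ∈ Sᵢ} pullbackEigenclasses Bᵢ ψᵢ (2p) ((x,y) ↦ (x + yμ)^{2p})`
  — i.e. a Weil class of `(Bᵢ, ℚ(ψᵢ))`, Deligne–Milne (4.3)–(4.4) — and `c = Σ fᵢ^* tᵢ`), and
  `HomPullback[]` is pull-back functoriality of `algebraicClasses` along homomorphisms of abelian
  varieties (Voisin II 9.21 (i) in the support rendering `Nᵖ H²ᵖ`; the tree proves it for FLAT maps
  only, `map_mem_algebraicClasses_of_flat`, restated as `homPullback_of_flat`; the closed-immersion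
  half needs Kleiman's moving-by-translates in every codimension, absent beyond codimension one,
  `AlgebraicClassesCupAbelianVariety`). Both hypotheses are theorems in print; the reduction is
  CONDITIONAL on them.
* `mem_pulledBackAlgebraicClasses_of_cmWeil_of_andre` — WITHOUT the pull-back hypothesis (and
  without `hM`): `CMWeil[]` ∧ `AndreSplitWeil[]` put every rational `(p,p)`-class (`0 < p`) of a CM
  abelian variety in the tree's REAL space `pulledBackAlgebraicClasses A.X p = PBᵖ(A)` (span of
  pull-backs of algebraic classes from smooth projective targets); `PBᵖ = algebraicClasses` on a smooth
  projective variety is precisely the tree's open pull-back question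
  (`pulledBackAlgebraicClasses_eq_algebraicClasses_iff`); `hccm_of_cmWeil_of_andre_of_forall_map_mem`
  is the reduction with the pull-back hypothesis in that general shape.
* `hccm_iff_pos` — `HCCM[]` is its cycle part in codimensions `p > 0` (codimension `0` is
  `algebraicClasses_zero`; the anti-vacuity conjunct is `nonempty_hodgeModel_abelianVariety`).
* Junk audit of `IsCM[A]`: `isCM_of_dim_eq_zero` — the degenerate end `dim A = 0` IS inside the binder
  (`Fin 0` is empty), and there the conclusion holds from the Hodge-model fact alone (landed:
  `Theorems/HodgeAbelianVarieties/Negative/ExtremeCodimensions`, `Negative.hodgeConjectureFor_of_dim_eq_zero`),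
  so the junk end neither refutes nor trivialises `HCCM[]`. For `dim A > 0`, `IsCM[A]` (an endomorphism
  with `2 dim A` distinct eigenvalues on the `2 dim A`-dimensional `H¹(A(ℂ); ℂ)`) says
  `ℚ[ψ] ⊆ End⁰(A)` is a commutative semisimple subalgebra of rank `2 dim A` (`End⁰(A) → End(H¹(A, ℚ))`
  is injective), i.e. `A` is of CM type in Deligne's (product) sense — the generality in which André's
  note is stated (DM endnote 18); Markman's Thm. 1.4 phrasing with one CM FIELD is the isotypic case.
  Conversely a CM `A` has such a `ψ` (an étale `ℚ`-algebra of rank `2g` is monogenic; scale the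
  generator into `End A`; its eigenvalues on `H¹ ⊗ ℂ` are the `2g` distinct `σ(β)`).
* `andreCM_of_hodgeAbelianVarieties`, `cmWeil_of_hodgeAbelianVarieties`,
  `hccm_of_hodgeAbelianVarieties` — antecedent, consequent and the stub itself are implied by the
  crux (HC for abelian varieties, `∀ A : AbelianVariety ℂ, HodgeConjectureFor A.dim A.X`, the crux's
  definiens by `Iff.rfl`): the stub cannot be refuted without refuting HC.

The Hodge-model fact. Every theorem concluding `HCCM[]` takes
`hM : ∀ n X, HodgeTheory.nonempty_hodgeModel n X` (the tree's named fact). `hM` is now a THEOREM of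
the tree: `nonempty_hodgeModel_all_holds` in
`Summits/HodgeConjecture/HodgeConjecture/Theorems/HeckePrymWeilWeilTwelvefoldsSqrtMinus7HodgeModelFacts.lean`
(namespace `Summit.HodgeConjecture.HodgeConjecture.Theorems.WeilTwelvefoldsSqrtMinus7.AmnesicSecantSheaves`;
Serre's analytification + de Rham's theorem `exists_complexDeRhamIsoFamily_holds` + the Hodge
decomposition `isInternal_hodgePQ_holds`, all proved; axioms `propext/Classical.choice/Quot.sound`,
re-checked by this seat), so every `hM` below is discharged by `nonempty_hodgeModel_all_holds`. It is
kept as a hypothesis ONLY to keep this file's import closure small and inside `Literature` (that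
theorem's closure runs through the Kähler / de Rham proof files, under active edit); likewise the route
file `Theses/PadicSemiregularLift` is not imported (the crux is used through its definiens).

Typing audit of `CMWeil[]` against André (informal, recorded for the lead): André needs Weil classes
for CM fields `K` of EVERY degree (not only imaginary quadratic ones), `W_K = ⋀^{2p}_K H¹(B, ℚ)`,
`2p = dim_K H¹(B, ℚ)`; with `ψ = N·η(β)` for a primitive `β` of `K` (`β ∉ K⁺`, so every `σ(β)` is
non-real), `S = {σ(Nβ)}`, the guards of `CMWeil[]` hold (`ψ^*` semisimple on `H¹`, eigenspaces
`H¹_σ` of dimension `dim_K H¹ = 2p`) and `W_K ⊗ ℂ = ⊕_σ ⋀^{2p} H¹_σ` is the eigen-span of `CMWeil[]`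
(characters `∏_σ (x + yσ(Nβ))^{a_σ}` are pairwise distinct polynomials because the `σ(β)` are
distinct). So `CMWeil[]` is exactly strong enough; it carries no split/polarisation guard, which only
makes it stronger than André requires (still HC-implied, `cmWeil_of_hodgeAbelianVarieties`).
-/

set_option linter.dupNamespace false

noncomputable section

open CategoryTheory AlgebraicGeometry
open Literature.AlgebraicGeometry Literature.AlgebraicGeometry.Motives

namespace Summit.HodgeConjecture.HodgeConjecture.Cruxes.HodgeAbelianVarieties.SubtorusGalleryBlochSeeds.Stubs

/-! ### The shared statements (copied verbatim from the registered skeleton) -/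

/-- `CMWeil[]` — Weil classes are algebraic for every CM-field action, on the tree's real carriers:
for `ψ ∈ End(A)` whose pull-back on `H¹(A(ℂ); ℂ)` is semisimple with non-real eigenvalues `μ ∈ S`,
each of multiplicity exactly `2p`, every rational `(p,p)`-class in the span of the top-wedge
eigenclass lines `⋀^{2p} H¹_μ = pullbackEigenclasses A ψ (2p) ((x,y) ↦ (x + yμ)^{2p})` is algebraic
(van Geemen 4.8–4.9; Deligne–Milne LNM 900 (4.3)–(4.4)). Local notation only (verbatim copy of the
skeleton's). -/
local notation3 (prettyPrint := false) "CMWeil[]" =>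
  ∀ (A : AbelianVariety ℂ) (ψ : A ⟶ A) (p : ℕ) (S : Finset ℂ), 0 < p →
    (∀ μ ∈ S, μ.im ≠ 0) →
    (⨆ μ ∈ S, Module.End.eigenspace (HodgeTheory.complexBetti.map ψ.hom.hom.hom 1).hom μ) = ⊤ →
    (∀ μ ∈ S, Module.finrank ℂ
        (Module.End.eigenspace (HodgeTheory.complexBetti.map ψ.hom.hom.hom 1).hom μ) = 2 * p) →
    ∀ c : HodgeTheory.complexBetti A.X (2 * p), HodgeTheory.IsRationalClass c →
      HodgeTheory.IsOfHodgeType A.dim A.X (2 * p) p p c →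
      c ∈ (⨆ μ ∈ S, HodgeTheory.pullbackEigenclasses A ψ (2 * p)
              (fun x y => ((x : ℂ) + (y : ℂ) * μ) ^ (2 * p))) →
      c ∈ HodgeTheory.algebraicClasses A.X p

/-- `IsCM[A]` — `A` is of CM type: some endomorphism of `A` has `2 · dim A` distinct eigenvalues on
`H¹(A(ℂ); ℂ)` (equivalently `End⁰(A) ⊇` an étale commutative `ℚ`-subalgebra of rank `2 dim A`;
Mumford, *Abelian Varieties* §22; Markman survey §1.1). Local notation only (verbatim copy of the
skeleton's). -/
local notation3 (prettyPrint := false) "IsCM[" A "]" =>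
  ∃ (ψ : A ⟶ A) (μ : Fin (2 * AbelianVariety.dim A) → ℂ), Function.Injective μ ∧
    ∀ i, Module.End.HasEigenvalue (HodgeTheory.complexBetti.map ψ.hom.hom.hom 1).hom (μ i)

/-- `HCCM[]` — the Hodge conjecture for complex abelian varieties of CM type. Local notation only
(verbatim copy of the skeleton's). -/
local notation3 (prettyPrint := false) "HCCM[]" =>
  ∀ A : AbelianVariety ℂ, IsCM[A] → HodgeTheory.HodgeConjectureFor A.dim A.X

/-! ### The two printed theorems the stub rests on, as explicit hypotheses (local notations) -/

/-- `AndreSplitWeil[]` — **André's decomposition, typed on the tree's carriers in the antecedent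
shape of `CMWeil[]`** (HYPOTHESIS of the reductions below, not asserted): for `A` of CM type and a
rational class `c` of Hodge type `(p,p)`, `0 < p`, there are finitely many abelian varieties `Bᵢ`,
homomorphisms `fᵢ : A ⟶ Bᵢ`, endomorphisms `ψᵢ` of `Bᵢ` and finite sets `Sᵢ ⊂ ℂ ∖ ℝ` (intended:
`ψᵢ = N·ηᵢ(βᵢ)` for a primitive element `βᵢ` of the CM field `Kᵢ` acting on `Bᵢ`, `Sᵢ` = its
conjugates) such that the `μ`-eigenspaces of `ψᵢ^*` on `H¹(Bᵢ(ℂ); ℂ)`, `μ ∈ Sᵢ`, exhaust `H¹` and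
have dimension exactly `2p` (`= dim_{Kᵢ} H¹(Bᵢ, ℚ)`), and rational `(p,p)`-classes `tᵢ` in the
eigen-span `⊕_σ ⋀^{2p} H¹_σ = W_{Kᵢ} ⊗ ℂ` (Weil classes of `(Bᵢ, Kᵢ)`; of type `(p,p)` because the `Bᵢ`
are of (split) Weil type) with `c = Σᵢ fᵢ^* tᵢ`. In print: André 1992 (for `A` of CM type in
Deligne's sense, DM endnote 18) = Markman's survey Thm. 1.4, with Deligne–Milne (4.3)–(4.4) for
`W_K ⊗ ℂ = ⊕_σ ⋀^d H¹_σ`; above the top degree (`dim A < p`) the class `c` is `0` and `m = 0` works.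
Local notation only. [cite: Andre1992HodgeCM, Théorème (pp. 1–7)] [cite: Markman2025SurveySecant, Thm. 1.4]
[cite: Deligne1982HodgeCycles, §4 (4.3)–(4.4) and endnote 18] -/
local notation3 (prettyPrint := false) "AndreSplitWeil[]" =>
  ∀ (A : AbelianVariety ℂ), IsCM[A] → ∀ (p : ℕ), 0 < p →
    ∀ c : HodgeTheory.complexBetti A.X (2 * p), HodgeTheory.IsRationalClass c →
      HodgeTheory.IsOfHodgeType A.dim A.X (2 * p) p p c →
      ∃ (m : ℕ) (B : Fin m → AbelianVariety ℂ) (f : ∀ i, A ⟶ B i) (ψ : ∀ i, B i ⟶ B i)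
        (S : Fin m → Finset ℂ) (t : ∀ i, HodgeTheory.complexBetti (B i).X (2 * p)),
        (∀ i, ∀ μ ∈ S i, μ.im ≠ 0) ∧
        (∀ i, (⨆ μ ∈ S i, Module.End.eigenspace
            (HodgeTheory.complexBetti.map (ψ i).hom.hom.hom 1).hom μ) = ⊤) ∧
        (∀ i, ∀ μ ∈ S i, Module.finrank ℂ (Module.End.eigenspace
            (HodgeTheory.complexBetti.map (ψ i).hom.hom.hom 1).hom μ) = 2 * p) ∧
        (∀ i, HodgeTheory.IsRationalClass (t i)) ∧
        (∀ i, HodgeTheory.IsOfHodgeType (B i).dim (B i).X (2 * p) p p (t i)) ∧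
        (∀ i, t i ∈ ⨆ μ ∈ S i, HodgeTheory.pullbackEigenclasses (B i) (ψ i) (2 * p)
            (fun x y => ((x : ℂ) + (y : ℂ) * μ) ^ (2 * p))) ∧
        c = ∑ i, HodgeTheory.complexBetti.map (f i).hom.hom.hom (2 * p) (t i)

/-- `HomPullback[]` — **pull-back along a homomorphism of complex abelian varieties preserves
algebraic classes** (HYPOTHESIS of the reduction below, not asserted): `f^*(Nᵖ H²ᵖ(B)) ⊆ Nᵖ H²ᵖ(A)`
for `f : A ⟶ B`, i.e. Voisin's "`i^* cl(Z) = cl(i^* Z)`" (Hodge Theory II, Prop. 9.21 (i)) / Fulton's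
contravariance of `cl` (Cor. 19.2 (b)) in the support rendering of `algebraicClasses`. The tree proves
the FLAT case (`map_mem_algebraicClasses_of_flat`, see `homPullback_of_flat`); a homomorphism factors
as a surjection (flat) followed by the closed immersion of an abelian subvariety, where Kleiman's
transversality of a general translate (Compositio 28 (1974) Thm. 2) would move the support — not in
the tree beyond codimension one (`AlgebraicClassesCupAbelianVariety`). Local notation only.
[cite: VoisinHodgeII2003, Prop. 9.21 (i)] [cite: Fulton1998, Cor. 19.2 (b)]
[cite: Kleiman1974Transversality, Thm. 2] -/
local notation3 (prettyPrint := false) "HomPullback[]" =>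
  ∀ (A B : AbelianVariety ℂ) (f : A ⟶ B) (p : ℕ) (a : HodgeTheory.complexBetti B.X (2 * p)),
    a ∈ HodgeTheory.algebraicClasses B.X p →
      HodgeTheory.complexBetti.map f.hom.hom.hom (2 * p) a ∈ HodgeTheory.algebraicClasses A.X p

/-! ### The anti-vacuity conjunct and the unfolding of `HCCM[]` -/

/-- **Every complex abelian variety has a Hodge model** — the anti-vacuity conjunct
`Nonempty (HodgeModel A.dim A.X)` of `HodgeConjectureFor A.dim A.X` from the named fact
`nonempty_hodgeModel` (Serre's compact Hausdorff analytification, de Rham's theorem with complex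
coefficients, the Hodge decomposition of the compact Kähler manifold `A^an ⊂ ℙᴺ(ℂ)`) applied to the
smooth projective `A.X` (`AbelianVariety.isSmoothProjective_holds`, proved). The fact `hM` is PROVED in
the tree (`nonempty_hodgeModel_all_holds`, module docstring) and is a hypothesis here only for import
hygiene. [cite: SerreGAGA1956, §2 n°5 Prop. 2 and n°7 Prop. 6] [cite: VoisinHodgeI2002, §6.1.3 Prop. 6.11] -/
theorem nonempty_hodgeModel_abelianVariety
    (hM : ∀ (n : ℕ) (X : SchemeOver ℂ), HodgeTheory.nonempty_hodgeModel n X) (A : AbelianVariety ℂ) :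
    Nonempty (HodgeTheory.HodgeModel A.dim A.X) :=
  hM A.dim A.X (AbelianVariety.isSmoothProjective_holds (A := A))

/-- **`HCCM[]` unfolds (given `hM`) to its cycle part in positive codimension**: the Hodge-model
conjunct is `nonempty_hodgeModel_abelianVariety`, and codimension `0` is everything
(`algebraicClasses_zero`, `hodgeConjectureFor_codim_zero`). [cite: Deligne2000, §1]
[cite: VoisinHodgeI2002, §11.3] -/
theorem hccm_iff_pos (hM : ∀ (n : ℕ) (X : SchemeOver ℂ), HodgeTheory.nonempty_hodgeModel n X) :
    HCCM[] ↔ ∀ A : AbelianVariety ℂ, IsCM[A] → ∀ p : ℕ, 0 < p →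
      ∀ c : HodgeTheory.complexBetti A.X (2 * p), HodgeTheory.IsRationalClass c →
        HodgeTheory.IsOfHodgeType A.dim A.X (2 * p) p p c →
          c ∈ HodgeTheory.algebraicClasses A.X p := by
  refine ⟨fun h A hA p _ c hc hh ↦ (h A hA).2 p c hc hh, fun h A hA ↦ ?_⟩
  refine ⟨nonempty_hodgeModel_abelianVariety hM A, fun p c hc hh ↦ ?_⟩
  rcases Nat.eq_zero_or_pos p with rfl | hp
  · exact HodgeTheory.hodgeConjectureFor_codim_zero c
  · exact h A hA p hp c hc hh

/-! ### Junk audit of `IsCM[A]`: the degenerate end is inside the binder and harmless -/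

/-- **`dim A = 0` is of CM type in the sense of `IsCM[A]`** (the eigenvalue family is indexed by the
empty type `Fin 0`; any endomorphism, here `0`, witnesses it). So the degenerate end of the binder of
`HCCM[]` is reached — and there the conclusion `HodgeConjectureFor 0 A.X` holds from the Hodge-model
fact alone (landed `Negative.hodgeConjectureFor_of_dim_eq_zero`: `p = 0` is everything, `H²ᵖ(pt) = 0`
for `p ≥ 1`), so it neither refutes nor trivialises the statement. [folklore] -/
theorem isCM_of_dim_eq_zero (A : AbelianVariety ℂ) (h : A.dim = 0) : IsCM[A] :=
  ⟨0, fun _ => 0, fun i => absurd i.2 (by omega), fun i => absurd i.2 (by omega)⟩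

/-! ### The honest reduction: `CMWeil[]` ∧ André ∧ pull-back functoriality ⟹ `HCCM[]` -/

/-- **Without the pull-back hypothesis: Hodge classes of CM abelian varieties are pulled-back
algebraic classes.** Granting `CMWeil[]` and André's decomposition `AndreSplitWeil[]` only, every
rational `(p,p)`-class `c` (`0 < p`) on a CM abelian variety `A` lies in the tree's real space
`PBᵖ(A) = pulledBackAlgebraicClasses A.X p`, the span of pull-backs of algebraic classes from smooth
projective targets (here the `Bᵢ`, smooth projective by `AbelianVariety.isSmoothProjective_holds`,
along the `fᵢ`): `c = Σ fᵢ^* tᵢ` with `tᵢ ∈ algebraicClasses Bᵢ.X p` by `CMWeil[]`, whose guards are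
exactly the data of `AndreSplitWeil[]`. The remaining step `PBᵖ(A) = algebraicClasses A.X p` is
exactly the tree's open pull-back question (`pulledBackAlgebraicClasses_eq_algebraicClasses_iff`).
CONDITIONAL on André's theorem only. [cite: Andre1992HodgeCM, Théorème (pp. 1–7)]
[cite: Markman2025SurveySecant, Thm. 1.4] [cite: Arapura2016SingularLefschetz, Lemma 8.6] -/
theorem mem_pulledBackAlgebraicClasses_of_cmWeil_of_andre (hW : CMWeil[]) (hAndre : AndreSplitWeil[])
    (A : AbelianVariety ℂ) (hA : IsCM[A]) {p : ℕ} (hp : 0 < p)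
    (c : HodgeTheory.complexBetti A.X (2 * p)) (hc : HodgeTheory.IsRationalClass c)
    (hh : HodgeTheory.IsOfHodgeType A.dim A.X (2 * p) p p c) :
    c ∈ HodgeTheory.pulledBackAlgebraicClasses A.X p := by
  obtain ⟨m, B, f, ψ, S, t, hS, htop, hrk, hrat, hhodge, hweil, rfl⟩ := hAndre A hA p hp c hc hh
  refine Submodule.sum_mem _ fun i _ ↦ ?_
  exact HodgeTheory.map_mem_pulledBackAlgebraicClasses
    (AbelianVariety.isSmoothProjective_holds (A := B i)) (f i).hom.hom.hom
    (hW (B i) (ψ i) p (S i) hp (hS i) (htop i) (hrk i) (t i) (hrat i) (hhodge i) (hweil i))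

/-- **André's reduction on the tree's carriers (CONDITIONAL form of `stub_andreCM`).** Granting
(i) André's decomposition `AndreSplitWeil[]` (André 1992 / Markman Thm. 1.4: every Hodge class on a CM
abelian variety is a sum of pull-backs `fᵢ^* tᵢ` of Weil classes `tᵢ` of split-Weil-type CM abelian
varieties `Bᵢ`, typed in the antecedent shape of `CMWeil[]`) and (ii) `HomPullback[]` (pull-backs of
algebraic classes along homomorphisms of abelian varieties are algebraic, Voisin II Prop. 9.21 (i)),
the engine output `CMWeil[]` gives the Hodge conjecture for every CM abelian variety: by
`hccm_iff_pos` only `0 < p` matters; there `c = Σ fᵢ^* tᵢ`, each `tᵢ` is algebraic on `Bᵢ` by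
`CMWeil[]` (its guards are exactly the data of `AndreSplitWeil[]`), each `fᵢ^* tᵢ` is algebraic by
(ii), and `algebraicClasses A.X p` is a submodule. The Hodge-model fact `hM` is proved in the tree
(`nonempty_hodgeModel_all_holds`). This theorem is CONDITIONAL on (i) and (ii), both theorems in
print and both absent from the tree. [cite: Andre1992HodgeCM, Théorème (pp. 1–7)]
[cite: Markman2025SurveySecant, Thm. 1.4] [cite: VoisinHodgeII2003, Prop. 9.21 (i)] -/
theorem hccm_of_cmWeil_of_andre_of_homPullback
    (hM : ∀ (n : ℕ) (X : SchemeOver ℂ), HodgeTheory.nonempty_hodgeModel n X)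
    (hW : CMWeil[]) (hAndre : AndreSplitWeil[]) (hpull : HomPullback[]) : HCCM[] := by
  refine (hccm_iff_pos hM).2 fun A hA p hp c hc hh ↦ ?_
  obtain ⟨m, B, f, ψ, S, t, hS, htop, hrk, hrat, hhodge, hweil, rfl⟩ := hAndre A hA p hp c hc hh
  refine Submodule.sum_mem _ fun i _ ↦ hpull A (B i) (f i) p (t i) ?_
  exact hW (B i) (ψ i) p (S i) hp (hS i) (htop i) (hrk i) (t i) (hrat i) (hhodge i) (hweil i)

/-- **Registered helper sub-goal `stub_andreCM_of_andre_of_homPullback`** (the CONDITIONAL form in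
which stub 3 is provable today, registered on the crux item as a sub-goal so that this `--supports`
file is creditable): Hodge models ∧ `CMWeil[]` ∧ André's decomposition ∧ pull-back functoriality
⟹ `HCCM[]`; this is `hccm_of_cmWeil_of_andre_of_homPullback` with its hypotheses as an implication
chain. The first antecedent is the tree's theorem `nonempty_hodgeModel_all_holds`; the third and
fourth are André 1992 and Voisin II Prop. 9.21 (i), unformalised.
[cite: Andre1992HodgeCM, Théorème (pp. 1–7)] [cite: VoisinHodgeII2003, Prop. 9.21 (i)] -/
theorem stub_andreCM_of_andre_of_homPullback :
    (∀ (n : ℕ) (X : SchemeOver ℂ), HodgeTheory.nonempty_hodgeModel n X) →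
      CMWeil[] → AndreSplitWeil[] → HomPullback[] → HCCM[] :=
  fun hM hW hAndre hpull ↦ hccm_of_cmWeil_of_andre_of_homPullback hM hW hAndre hpull

/-- **The same reduction with the pull-back hypothesis in the tree's general shape** (pull-backs from
ALL smooth projective targets preserve algebraic classes on `A.X`, the hypothesis `hpull` of
`PulledBackAlgebraicClasses`): `CMWeil[]` ∧ `AndreSplitWeil[]` ∧ `hpull` ⟹ `HCCM[]`, through
`mem_pulledBackAlgebraicClasses_of_cmWeil_of_andre` and
`mem_algebraicClasses_of_mem_pulledBackAlgebraicClasses`. CONDITIONAL on André's theorem and on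
Voisin II Prop. 9.21 (i). [cite: VoisinHodgeII2003, Prop. 9.21 (i)] [cite: Markman2025SurveySecant, Thm. 1.4] -/
theorem hccm_of_cmWeil_of_andre_of_forall_map_mem
    (hM : ∀ (n : ℕ) (X : SchemeOver ℂ), HodgeTheory.nonempty_hodgeModel n X)
    (hW : CMWeil[]) (hAndre : AndreSplitWeil[])
    (hpull : ∀ (A : AbelianVariety ℂ) (p : ℕ) ⦃m : ℕ⦄ ⦃Y : SchemeOver ℂ⦄, IsSmoothProjective m Y →
      ∀ (g : A.X ⟶ Y) ⦃a : HodgeTheory.complexBetti Y (2 * p)⦄, a ∈ HodgeTheory.algebraicClasses Y p →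
        (HodgeTheory.complexBetti.map g (2 * p)).hom a ∈ HodgeTheory.algebraicClasses A.X p) :
    HCCM[] := by
  refine (hccm_iff_pos hM).2 fun A hA p hp c hc hh ↦ ?_
  exact HodgeTheory.mem_algebraicClasses_of_mem_pulledBackAlgebraicClasses
    (AbelianVariety.isSmoothProjective_holds (A := A)) (hpull A p)
    (mem_pulledBackAlgebraicClasses_of_cmWeil_of_andre hW hAndre A hA hp c hc hh)

/-- **The flat case of `HomPullback[]` is in the tree**: pull-back along a homomorphism of complex
abelian varieties whose underlying morphism of schemes is flat (isogenies, surjective homomorphisms —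
flatness itself being a hypothesis, as in `WeilClassesIsogenyDescent`) preserves `algebraicClasses`
(`map_mem_algebraicClasses_of_flat`; abelian varieties are smooth projective, hence locally
Noetherian). What `HomPullback[]` adds is the closed-immersion half.
[cite: GrothendieckTopology1969, §1] [cite: Hartshorne1977, III Prop. 9.5] -/
theorem homPullback_of_flat (A B : AbelianVariety ℂ) (f : A ⟶ B) [Flat f.hom.hom.hom.left] (p : ℕ)
    (a : HodgeTheory.complexBetti B.X (2 * p)) (ha : a ∈ HodgeTheory.algebraicClasses B.X p) :
    HodgeTheory.complexBetti.map f.hom.hom.hom (2 * p) a ∈ HodgeTheory.algebraicClasses A.X p := by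
  haveI : IsLocallyNoetherian A.X.left :=
    IsSmoothProjective.isLocallyNoetherian_holds (AbelianVariety.isSmoothProjective_holds (A := A))
  haveI : IsLocallyNoetherian B.X.left :=
    IsSmoothProjective.isLocallyNoetherian_holds (AbelianVariety.isSmoothProjective_holds (A := B))
  exact HodgeTheory.map_mem_algebraicClasses_of_flat f.hom.hom.hom ha

/-! ### The stub, its antecedent and its consequent are HC-implied (no kill short of a kill of HC) -/

/-- The crux `HodgeAbelianVarieties` — by `Iff.rfl` the formula `∀ A : AbelianVariety ℂ,
HodgeConjectureFor A.dim A.X`, HC for all complex abelian varieties — implies `HCCM[]` (restrict the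
binder). [folklore] -/
theorem hccm_of_hodgeAbelianVarieties
    (h : ∀ A : AbelianVariety ℂ, HodgeTheory.HodgeConjectureFor A.dim A.X) : HCCM[] :=
  fun A _ ↦ h A

/-- The crux (as the formula `∀ A : AbelianVariety ℂ, HodgeConjectureFor A.dim A.X`) implies `CMWeil[]`
(its conclusion is an instance of the cycle part of `HodgeConjectureFor`; the guards and the
eigen-span hypothesis are not used). [folklore] -/
theorem cmWeil_of_hodgeAbelianVarieties
    (h : ∀ A : AbelianVariety ℂ, HodgeTheory.HodgeConjectureFor A.dim A.X) : CMWeil[] :=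
  fun A _ p _ _ _ _ _ c hc hh _ ↦ (h A).2 p c hc hh

/-- **The stub `CMWeil[] → HCCM[]` is implied by the crux** `∀ A : AbelianVariety ℂ,
HodgeConjectureFor A.dim A.X` (hence by the Hodge conjecture): it cannot be refuted without refuting
HC for abelian varieties. [folklore] -/
theorem andreCM_of_hodgeAbelianVarieties
    (h : ∀ A : AbelianVariety ℂ, HodgeTheory.HodgeConjectureFor A.dim A.X) : CMWeil[] → HCCM[] :=
  fun _ ↦ hccm_of_hodgeAbelianVarieties h

end Summit.HodgeConjecture.HodgeConjecture.Cruxes.HodgeAbelianVarieties.SubtorusGalleryBlochSeeds.Stubs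

end
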